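import Literature.Probability.RandomMatrix.SphereTruncationTV
import Literature.Probability.RandomMatrix.GaussianContractionTV
import HarnessLib

/-!
# One step of the hybrid argument for truncations of Haar unitaries

Fix `1 ≤ n`, `2n ≤ m`, and a subspace `V ≤ ℂ^m` of dimension `≤ n − 1` (the span of the
previously produced Gram–Schmidt vectors). For a standard complex Gaussian vector `x ∈ ℂ^m` let
`P x` be its orthogonal projection onto `Vᗮ` (the Gram–Schmidt residual). The next column of the
scaled truncated Haar unitary is `√m · (P x/‖P x‖)` restricted to the first `n` coordinates
(`truncProjNormalize`). The main result `tvClose_truncProjNormalize` bounds its distance to a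
fresh standard complex Gaussian vector of `ℂ^n`:

  `‖Law(truncProjNormalize x) − γ^n‖_TV ≤ 8n²/m + 2 ∑_{i<n} ‖P_V e_i‖²`.

Proof: choose an orthonormal basis `b` of `Vᗮ` indexed by `Fin n ⊕ Fin p` whose `inr`-vectors
have vanishing first `n` coordinates (`exists_adapted_orthonormalBasis`, a dimension count). In the
coordinates `L x = (⟪b_k, x⟫)_k` — a standard Gaussian vector of `ℂ^{n+p}`
(`gaussianEuc_map_orthonormal_repr`) — the column equals `N · sphereTrunc (L x)` with
`N_{il} = (b_{inl l})_i` (`truncProjNormalize_eq`). Then combine the sphere-truncation bound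
(`tvClose_sphereTrunc`, pushed forward by `N`) with the contraction bound
(`tvClose_gaussianPi_map_mulVec`; `1 − N Nᴴ ≥ 0` since `Nᴴ y = (⟪b_{inl l}, ι y⟫)_l` and Bessel),
and identify `n − ∑|N_{il}|² = ∑_{i<n} ‖P_V e_i‖²` (Parseval in `Vᗮ` and Pythagoras).
-/

open MeasureTheory ProbabilityTheory WithLp Matrix InnerProductSpace Submodule Module
open scoped ENNReal NNReal ComplexOrder

namespace Literature.Probability.RandomMatrix

open Literature.MeasureTheory.TotalVariation

variable {m n : ℕ}

/-! ### The column map -/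

/-- The next column of the hybrid: `√m · (P x/‖P x‖)` restricted to the first `n` coordinates,
`P` the orthogonal projection onto `Vᗮ` (with `0⁻¹ = 0`). [folklore] -/
noncomputable def truncProjNormalize (hle : n ≤ m) (V : Submodule ℂ (EuclideanSpace ℂ (Fin m)))
    (x : EuclideanSpace ℂ (Fin m)) : Fin n → ℂ :=
  fun i => (Real.sqrt m : ℂ) * ((((‖Vᗮ.starProjection x‖⁻¹ : ℝ) : ℂ)) *
    (Vᗮ.starProjection x) (Fin.castLE hle i))

/-- `truncProjNormalize` is measurable. [folklore] -/
theorem measurable_truncProjNormalize (hle : n ≤ m) (V : Submodule ℂ (EuclideanSpace ℂ (Fin m))) :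
    Measurable (truncProjNormalize hle V) := by
  have hP : Continuous fun x : EuclideanSpace ℂ (Fin m) => Vᗮ.starProjection x :=
    Vᗮ.starProjection.continuous
  refine measurable_pi_lambda _ fun i => ?_
  refine Measurable.mul measurable_const (Measurable.mul ?_ ?_)
  · exact Complex.measurable_ofReal.comp (hP.norm.measurable.inv)
  · exact (measurable_pi_apply (Fin.castLE hle i)).comp ((measurable_ofLp_two (Fin m)).comp hP.measurable)

/-! ### Parseval identities in `Vᗮ` -/

section Parseval

variable {ι : Type*} [Fintype ι] {K : Submodule ℂ (EuclideanSpace ℂ (Fin m))}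

/-- `P_K z = ∑ ⟪b_k, z⟫ b_k` for an orthonormal basis `b` of `K`. [folklore] -/
theorem starProjection_eq_sum_orthonormalBasis (b : OrthonormalBasis ι ℂ K) (z : EuclideanSpace ℂ (Fin m)) :
    K.starProjection z = ∑ k, inner ℂ (b k : EuclideanSpace ℂ (Fin m)) z • (b k : EuclideanSpace ℂ (Fin m)) := by
  rw [starProjection_apply, b.orthogonalProjectionOnto_apply_eq_sum, Submodule.coe_sum]
  simp only [Submodule.coe_smul]

/-- `⟪b_k, P_K z⟫ = ⟪b_k, z⟫` for `b_k ∈ K`. [folklore] -/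
theorem inner_coe_starProjection (b : OrthonormalBasis ι ℂ K) (z : EuclideanSpace ℂ (Fin m)) (k : ι) :
    inner ℂ (b k : EuclideanSpace ℂ (Fin m)) (K.starProjection z) = inner ℂ (b k : EuclideanSpace ℂ (Fin m)) z := by
  have h := starProjection_inner_eq_zero z (b k : EuclideanSpace ℂ (Fin m)) (b k).2
  rw [inner_sub_left, sub_eq_zero] at h
  rw [← inner_conj_symm, ← h, inner_conj_symm]

/-- **Parseval in `K`**: `‖P_K z‖² = ∑ |⟪b_k, z⟫|²`. [folklore] -/
theorem norm_sq_starProjection_eq_sum (b : OrthonormalBasis ι ℂ K) (z : EuclideanSpace ℂ (Fin m)) :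
    ‖K.starProjection z‖ ^ 2 = ∑ k, ‖inner ℂ (b k : EuclideanSpace ℂ (Fin m)) z‖ ^ 2 := by
  rw [starProjection_apply, ← Submodule.coe_norm, ← b.repr.norm_map, EuclideanSpace.norm_sq_eq]
  refine Finset.sum_congr rfl fun k _ => ?_
  rw [b.repr_apply_apply, Submodule.coe_inner, ← starProjection_apply, inner_coe_starProjection]

end Parseval

/-! ### The adapted orthonormal basis of `Vᗮ` -/

/-- The truncation to the first `n` coordinates as a linear map. [folklore] -/
noncomputable def truncLin (hle : n ≤ m) : EuclideanSpace ℂ (Fin m) →ₗ[ℂ] (Fin n → ℂ) where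
  toFun x i := x (Fin.castLE hle i)
  map_add' x y := by funext i; rfl
  map_smul' c x := by funext i; rfl

/-- **Adapted orthonormal basis.** If `dim Vᗮ = n + p`, there is an orthonormal basis of `Vᗮ`
indexed by `Fin n ⊕ Fin p` whose `inr`-vectors have vanishing first `n` coordinates (the kernel of
the truncation restricted to `Vᗮ` has dimension `≥ p`). [folklore] -/
theorem exists_adapted_orthonormalBasis (hle : n ≤ m) (V : Submodule ℂ (EuclideanSpace ℂ (Fin m)))
    {p : ℕ} (hp : finrank ℂ Vᗮ = n + p) :
    ∃ b : OrthonormalBasis (Fin n ⊕ Fin p) ℂ Vᗮ,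
      ∀ (j : Fin p) (i : Fin n), ((b (Sum.inr j) : EuclideanSpace ℂ (Fin m))) (Fin.castLE hle i) = 0 := by
  set K := Vᗮ with hK
  set TK : K →ₗ[ℂ] (Fin n → ℂ) := (truncLin hle).comp K.subtype with hTK
  set W : Submodule ℂ K := LinearMap.ker TK with hW
  -- `dim W ≥ p`
  have hWp : p ≤ finrank ℂ W := by
    have h1 := LinearMap.finrank_range_add_finrank_ker TK
    have h2 : finrank ℂ (LinearMap.range TK) ≤ n := by
      calc finrank ℂ (LinearMap.range TK) ≤ finrank ℂ (Fin n → ℂ) := Submodule.finrank_le _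
        _ = n := by simp
    rw [← hW] at h1
    omega
  set c := stdOrthonormalBasis ℂ W with hc
  -- the partial family
  let u : Fin p → K := fun j => (c ⟨j, lt_of_lt_of_le j.2 hWp⟩ : W)
  have hu : Orthonormal ℂ u := by
    have h1 : Orthonormal ℂ (fun j : Fin p => c ⟨j, lt_of_lt_of_le j.2 hWp⟩) :=
      c.orthonormal.comp _ (fun j j' h => Fin.ext (by simpa using congrArg Fin.val h))
    exact (W.subtypeₗᵢ.orthonormal_comp_iff).2 h1
  let v : Fin n ⊕ Fin p → K := fun k => Sum.elim (fun _ => (0 : K)) u k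
  have hv : Orthonormal ℂ ((Set.range (Sum.inr : Fin p → Fin n ⊕ Fin p)).restrict v) := by
    rw [orthonormal_iff_ite]
    rintro ⟨_, j, rfl⟩ ⟨_, j', rfl⟩
    have := (orthonormal_iff_ite.1 hu) j j'
    simp only [Set.restrict_apply, v, Sum.elim_inr]
    rw [this]
    simp [Subtype.ext_iff]
  have hcard : finrank ℂ K = Fintype.card (Fin n ⊕ Fin p) := by
    rw [Fintype.card_sum, Fintype.card_fin, Fintype.card_fin]; exact hp
  obtain ⟨b, hb⟩ := Orthonormal.exists_orthonormalBasis_extension_of_card_eq hcard hv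
  refine ⟨b, fun j i => ?_⟩
  have hbj : b (Sum.inr j) = u j := by
    rw [hb (Sum.inr j) (Set.mem_range_self j)]; rfl
  have hker : TK (u j) = 0 := LinearMap.mem_ker.1 (c ⟨j, lt_of_lt_of_le j.2 hWp⟩).2
  have := congrFun hker i
  rw [hbj]
  exact this

/-! ### The factorisation through `sphereTrunc` -/

section Factor

variable (hle : n ≤ m) {V : Submodule ℂ (EuclideanSpace ℂ (Fin m))} {p : ℕ}
  (b : OrthonormalBasis (Fin n ⊕ Fin p) ℂ Vᗮ)

/-- The coefficient matrix `N_{il} = (b_{inl l})_{castLE i}`. [folklore] -/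
noncomputable def coeffMatrix : Matrix (Fin n) (Fin n) ℂ :=
  fun i l => ((b (Sum.inl l) : EuclideanSpace ℂ (Fin m))) (Fin.castLE hle i)

/-- The coordinate map `L z = (⟪b_k, z⟫)_k`. [folklore] -/
noncomputable def coordMap (z : EuclideanSpace ℂ (Fin m)) : Fin n ⊕ Fin p → ℂ :=
  fun k => inner ℂ (b k : EuclideanSpace ℂ (Fin m)) z

/-- `coordMap` is measurable. [folklore] -/
theorem measurable_coordMap : Measurable (coordMap b) :=
  measurable_pi_lambda _ fun _ => (continuous_const.inner continuous_id).measurable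

/-- In the adapted basis the first `n` coordinates of `P z` are `N · (L z)_{inl}`. [folklore] -/
theorem starProjection_apply_castLE
    (hb0 : ∀ (j : Fin p) (i : Fin n), ((b (Sum.inr j) : EuclideanSpace ℂ (Fin m))) (Fin.castLE hle i) = 0)
    (z : EuclideanSpace ℂ (Fin m)) (i : Fin n) :
    (Vᗮ.starProjection z) (Fin.castLE hle i) =
      (coeffMatrix hle b *ᵥ fun l => coordMap b z (Sum.inl l)) i := by
  rw [starProjection_eq_sum_orthonormalBasis b z]
  change (∑ k, inner ℂ (b k : EuclideanSpace ℂ (Fin m)) z • (b k : EuclideanSpace ℂ (Fin m))).ofLp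
    (Fin.castLE hle i) = _
  rw [WithLp.ofLp_sum, Finset.sum_apply, Fintype.sum_sum_type]
  simp only [WithLp.ofLp_smul, Pi.smul_apply, smul_eq_mul]
  have h0 : ∑ j : Fin p, inner ℂ (b (Sum.inr j) : EuclideanSpace ℂ (Fin m)) z *
      ((b (Sum.inr j) : EuclideanSpace ℂ (Fin m))).ofLp (Fin.castLE hle i) = 0 :=
    Finset.sum_eq_zero fun j _ => by rw [show ((b (Sum.inr j) : EuclideanSpace ℂ (Fin m))).ofLp
      (Fin.castLE hle i) = 0 from hb0 j i, mul_zero]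
  rw [h0, add_zero, mulVec, dotProduct]
  refine Finset.sum_congr rfl fun l _ => ?_
  simp only [coeffMatrix, coordMap]
  ring

/-- `‖P z‖ = √(∑ |(L z)_k|²)`. [folklore] -/
theorem norm_starProjection_eq_sqrt (z : EuclideanSpace ℂ (Fin m)) :
    ‖Vᗮ.starProjection z‖ = Real.sqrt (∑ k, ‖coordMap b z k‖ ^ 2) := by
  simp only [coordMap]
  rw [← norm_sq_starProjection_eq_sum b z, Real.sqrt_sq (norm_nonneg _)]


/-- **Factorisation**: `truncProjNormalize = (N ·) ∘ sphereTrunc n p m ∘ L`. [folklore] -/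
theorem truncProjNormalize_eq
    (hb0 : ∀ (j : Fin p) (i : Fin n), ((b (Sum.inr j) : EuclideanSpace ℂ (Fin m))) (Fin.castLE hle i) = 0) :
    truncProjNormalize hle V =
      (fun y => coeffMatrix hle b *ᵥ y) ∘ sphereTrunc n p (m : ℝ) ∘ coordMap b := by
  funext z; funext i
  simp only [Function.comp_apply, truncProjNormalize]
  rw [starProjection_apply_castLE hle b hb0 z i, norm_starProjection_eq_sqrt b z]
  have hs : sphereTrunc n p (m : ℝ) (coordMap b z) =
      (((Real.sqrt m / Real.sqrt (∑ k, ‖coordMap b z k‖ ^ 2) : ℝ) : ℂ)) •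
        fun l => coordMap b z (Sum.inl l) := by
    funext l; rfl
  rw [hs, mulVec_smul, Pi.smul_apply, smul_eq_mul, ← mul_assoc]
  congr 1
  push_cast
  ring

end Factor

/-! ### `N` is a contraction: `1 − N Nᴴ ≥ 0` -/

section Contraction

variable (hle : n ≤ m) {V : Submodule ℂ (EuclideanSpace ℂ (Fin m))} {p : ℕ}
  (b : OrthonormalBasis (Fin n ⊕ Fin p) ℂ Vᗮ)

/-- The embedded vector `ι y = ∑ᵢ yᵢ e_{castLE i}`. [folklore] -/
noncomputable def embedVec (y : Fin n → ℂ) : EuclideanSpace ℂ (Fin m) :=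
  ∑ i, y i • EuclideanSpace.single (Fin.castLE hle i) (1:ℂ)

/-- `‖ι y‖² = ∑ |yᵢ|²` (orthonormality of the standard vectors). [folklore] -/
theorem inner_embedVec_self (y : Fin n → ℂ) :
    inner ℂ (embedVec hle y) (embedVec hle y) = ((∑ i, ‖y i‖ ^ 2 : ℝ) : ℂ) := by
  have hon : Orthonormal ℂ (fun i : Fin n => EuclideanSpace.single (Fin.castLE hle i) (1:ℂ)) :=
    (EuclideanSpace.orthonormal_single).comp _ (Fin.castLE_injective hle)
  unfold embedVec
  rw [hon.inner_sum]
  push_cast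
  refine Finset.sum_congr rfl fun i _ => ?_
  rw [Complex.conj_mul']

/-- `(Nᴴ y)_l = ⟪b_{inl l}, ι y⟫`. [folklore] -/
theorem conjTranspose_coeffMatrix_mulVec (y : Fin n → ℂ) (l : Fin n) :
    ((coeffMatrix hle b)ᴴ *ᵥ y) l = inner ℂ (b (Sum.inl l) : EuclideanSpace ℂ (Fin m)) (embedVec hle y) := by
  unfold embedVec
  rw [inner_sum, mulVec, dotProduct]
  refine Finset.sum_congr rfl fun i _ => ?_
  rw [inner_smul_right, EuclideanSpace.inner_single_right, one_mul, conjTranspose_apply]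
  simp only [coeffMatrix]
  rw [mul_comm]
  rfl

/-- `‖P_K u‖ ≤ ‖u‖`. [folklore] -/
theorem norm_starProjection_le (K : Submodule ℂ (EuclideanSpace ℂ (Fin m))) (u : EuclideanSpace ℂ (Fin m)) :
    ‖K.starProjection u‖ ^ 2 ≤ ‖u‖ ^ 2 := by
  rw [Submodule.norm_sq_eq_add_norm_sq_projection u K, starProjection_apply, Submodule.coe_norm]
  nlinarith [sq_nonneg ‖Kᗮ.orthogonalProjectionOnto u‖]

/-- **`1 − N Nᴴ` is positive semidefinite** (`‖Nᴴy‖² = ∑_l |⟪b_{inl l}, ι y⟫|² ≤ ‖P ι y‖² ≤ ‖ι y‖²`).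
[folklore] -/
theorem posSemidef_one_sub_coeffMatrix_mul_conjTranspose :
    (1 - coeffMatrix hle b * (coeffMatrix hle b)ᴴ).PosSemidef := by
  set N := coeffMatrix hle b with hN
  refine PosSemidef.of_dotProduct_mulVec_nonneg ?_ fun y => ?_
  · exact (isHermitian_one.sub (isHermitian_mul_conjTranspose_self N))
  -- `y† (1 - N Nᴴ) y = ‖y‖² - ‖Nᴴ y‖²`
  have h2 : star y ᵥ* N = star (Nᴴ *ᵥ y) := by
    rw [star_mulVec, conjTranspose_conjTranspose]
  have h1 : star y ⬝ᵥ ((1 - N * Nᴴ) *ᵥ y) = star y ⬝ᵥ y - star (Nᴴ *ᵥ y) ⬝ᵥ (Nᴴ *ᵥ y) := by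
    rw [sub_mulVec, one_mulVec, dotProduct_sub, ← mulVec_mulVec, dotProduct_mulVec, h2]
  have hyy : star y ⬝ᵥ y = ((∑ i, ‖y i‖ ^ 2 : ℝ) : ℂ) := by
    rw [dotProduct]
    push_cast
    refine Finset.sum_congr rfl fun i _ => ?_
    rw [Pi.star_apply, Complex.star_def, Complex.conj_mul']
  set u := embedVec hle y with hu
  have hNN : star (Nᴴ *ᵥ y) ⬝ᵥ (Nᴴ *ᵥ y) =
      ((∑ l, ‖inner ℂ (b (Sum.inl l) : EuclideanSpace ℂ (Fin m)) u‖ ^ 2 : ℝ) : ℂ) := by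
    rw [dotProduct]
    push_cast
    refine Finset.sum_congr rfl fun l _ => ?_
    rw [Pi.star_apply, Complex.star_def, Complex.conj_mul', hN, conjTranspose_coeffMatrix_mulVec]
  rw [h1, hyy, hNN, ← Complex.ofReal_sub, Complex.zero_le_real, sub_nonneg]
  -- Bessel: `∑_l |⟪b_{inl l}, u⟫|² ≤ ‖P u‖² ≤ ‖u‖² = ∑ |y_i|²`
  have hB : ∑ l, ‖inner ℂ (b (Sum.inl l) : EuclideanSpace ℂ (Fin m)) u‖ ^ 2 ≤ ‖Vᗮ.starProjection u‖ ^ 2 := by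
    rw [norm_sq_starProjection_eq_sum b u, Fintype.sum_sum_type]
    have : 0 ≤ ∑ j : Fin p, ‖inner ℂ (b (Sum.inr j) : EuclideanSpace ℂ (Fin m)) u‖ ^ 2 :=
      Finset.sum_nonneg fun j _ => by positivity
    linarith
  have hu2 : ‖u‖ ^ 2 = ∑ i, ‖y i‖ ^ 2 := by
    have := inner_embedVec_self hle y
    rw [← hu] at this
    have h := congrArg Complex.re this
    rw [Complex.ofReal_re] at h
    rw [← h, ← inner_self_eq_norm_sq (𝕜 := ℂ)]
    rfl
  calc ∑ l, ‖inner ℂ (b (Sum.inl l) : EuclideanSpace ℂ (Fin m)) u‖ ^ 2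
      ≤ ‖Vᗮ.starProjection u‖ ^ 2 := hB
    _ ≤ ‖u‖ ^ 2 := norm_starProjection_le _ u
    _ = ∑ i, ‖y i‖ ^ 2 := hu2

/-- **The trace identity**: `∑_{i,l} |N_{il}|² = ∑_{i<n} (1 − ‖P_V e_{castLE i}‖²)`. [folklore] -/
theorem sum_norm_sq_coeffMatrix
    (hb0 : ∀ (j : Fin p) (i : Fin n), ((b (Sum.inr j) : EuclideanSpace ℂ (Fin m))) (Fin.castLE hle i) = 0) :
    ∑ i, ∑ l, ‖coeffMatrix hle b i l‖ ^ 2 =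
      ∑ i : Fin n, (1 - ‖V.starProjection (EuclideanSpace.single (Fin.castLE hle i) (1:ℂ))‖ ^ 2) := by
  refine Finset.sum_congr rfl fun i _ => ?_
  set e : EuclideanSpace ℂ (Fin m) := EuclideanSpace.single (Fin.castLE hle i) (1:ℂ) with he
  -- Pythagoras for `e`
  have hpy : ‖V.starProjection e‖ ^ 2 + ‖Vᗮ.starProjection e‖ ^ 2 = 1 := by
    have h := Submodule.norm_sq_eq_add_norm_sq_projection e V
    rw [Submodule.coe_norm, Submodule.coe_norm, ← starProjection_apply, ← starProjection_apply] at h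
    have he1 : ‖e‖ = 1 := (EuclideanSpace.orthonormal_single (𝕜 := ℂ)).1 (Fin.castLE hle i)
    rw [he1, one_pow] at h
    linarith
  -- Parseval for `Vᗮ` and `e`
  have hpar : ‖Vᗮ.starProjection e‖ ^ 2 = ∑ l, ‖coeffMatrix hle b i l‖ ^ 2 := by
    rw [norm_sq_starProjection_eq_sum b e, Fintype.sum_sum_type]
    have h0 : ∑ j : Fin p, ‖inner ℂ (b (Sum.inr j) : EuclideanSpace ℂ (Fin m)) e‖ ^ 2 = 0 :=
      Finset.sum_eq_zero fun j _ => by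
        rw [he, EuclideanSpace.inner_single_right, one_mul]
        rw [show ((b (Sum.inr j) : EuclideanSpace ℂ (Fin m))).ofLp (Fin.castLE hle i) = 0 from hb0 j i]
        simp
    rw [h0, add_zero]
    refine Finset.sum_congr rfl fun l _ => ?_
    rw [he, EuclideanSpace.inner_single_right, one_mul, Complex.norm_conj]
    rfl
  linarith

end Contraction

/-! ### The step bound -/

/-- **One hybrid step.** For `1 ≤ n`, `2n ≤ m` and `dim V ≤ n − 1`, the column
`truncProjNormalize x` of a standard complex Gaussian vector `x ∈ ℂ^m` satisfies
`‖Law(truncProjNormalize x) − γ^n‖_TV ≤ 8n²/m + 2 ∑_{i<n} ‖P_V e_{castLE i}‖²` (setwise). [folklore] -/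
theorem tvClose_truncProjNormalize (hn : 1 ≤ n) (hmn : 2 * n ≤ m) (hle : n ≤ m)
    (V : Submodule ℂ (EuclideanSpace ℂ (Fin m))) (hV : finrank ℂ V + 1 ≤ n) :
    TVClose (gaussianPi (Fin n)) ((gaussianEuc (Fin m)).map (truncProjNormalize hle V))
      (8 * (n:ℝ) ^ 2 / m +
        2 * ∑ i : Fin n, ‖V.starProjection (EuclideanSpace.single (Fin.castLE hle i) (1:ℂ))‖ ^ 2) := by
  -- dimension count
  have hdim := Submodule.finrank_add_finrank_orthogonal V
  rw [finrank_euclideanSpace, Fintype.card_fin] at hdim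
  obtain ⟨p, hp⟩ : ∃ p, finrank ℂ Vᗮ = n + p := ⟨finrank ℂ Vᗮ - n, by omega⟩
  have hp1 : 1 ≤ p := by omega
  have hpm : p ≤ m := by omega
  have hm2 : m ≤ 2 * n + p := by omega
  obtain ⟨b, hb0⟩ := exists_adapted_orthonormalBasis hle V hp
  -- the coordinate map pushes `γ` to `γ^{n+p}`
  have hbon : Orthonormal ℂ (fun k => (b k : EuclideanSpace ℂ (Fin m))) :=
    (Vᗮ.subtypeₗᵢ.orthonormal_comp_iff).2 b.orthonormal
  have hL : (gaussianEuc (Fin m)).map (coordMap b) = gaussianPi (Fin n ⊕ Fin p) :=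
    gaussianEuc_map_orthonormal_repr hbon
  have hN : Measurable fun y : Fin n → ℂ => coeffMatrix hle b *ᵥ y :=
    (Matrix.mulVecLin (coeffMatrix hle b)).continuous_of_finiteDimensional.measurable
  rw [truncProjNormalize_eq hle b hb0,
    ← Measure.map_map hN ((measurable_sphereTrunc n p (m:ℝ)).comp (measurable_coordMap b)),
    ← Measure.map_map (measurable_sphereTrunc n p (m:ℝ)) (measurable_coordMap b), hL]
  have h1 := (tvClose_gaussianPi_map_mulVec (coeffMatrix hle b)
    (posSemidef_one_sub_coeffMatrix_mul_conjTranspose hle b)).symm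
  have h2 := ((tvClose_sphereTrunc (n := n) (p := p) (m := m) hn hp1 hpm hm2).map hN).symm
  refine (h1.triangle h2).mono (le_of_eq ?_)
  rw [sum_norm_sq_coeffMatrix hle b hb0, Finset.sum_sub_distrib, Finset.sum_const, Finset.card_univ,
    Fintype.card_fin]
  simp only [nsmul_eq_mul, mul_one]
  ring

end Literature.Probability.RandomMatrix
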